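import Literature.Computability.QuantumComplexity.CleanBlockDesc
import HarnessLib

/-!
# The description of a REVERSED clean block is polynomial time

Topic `Computability/QuantumComplexity`, companion of `CleanBlockDesc.lean`. The clean XOR blocks
(`CleanXor.ops = P ++ xorOps ++ P.reverse`, `P` a placed copy of `RevClean.cleanOps`) contain the clean block
REVERSED AS A PROGRAM; with an empty suffix, `(cleanOps e M N []).reverse = comp ++ reverse outOps ++ reverse comp`
(only the read-out changes its order). This file prints its description in polynomial time from the three generators of
`RevUncomputeUniform.lean`: the forward compute generator (`compGW opsG`), the read-out generator with REVERSED tokens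
(`outGW opsGR`, rendered backwards: `render_reverse_out_mem_FP`), and the backward compute generator (`compGW opsGR`,
rendered backwards) —

* `RevClean.cleanOps_nil_reverse` — the list identity;
* `RevClean.reverse_out_outGR` — the reversed stream of `outGW opsGR` is the token stream of `reverse outOps`;
* **`RevClean.flatMap_opBits_cleanOps_reverse_mem_FP`** — for a tableau length `N(u)` given by an expression in the
  family index, `1ᵘ ↦ ((cleanOps e M (N u) []).reverse).flatMap opBits ∈ FP`; instance `…_id` (`N(u) = u`).

(The bridge `RevDesc.codeFP_progA_of_mem_FP` of `OpBitsAbstract.lean` turns it into the abstract word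
`progA (cleanOps e M (N u) []).reverse` on codes.) Everything is proved; no named fact is introduced.

## References

* C. H. Bennett, *Logical reversibility of computation*, IBM J. Res. Dev. 17 (1973), §2 [Bennett1973].
* S. Arora, B. Barak, *Computational Complexity: A Modern Approach*, CUP 2009, §6.2 Def. 6.12 and Remark 6.7
  [AroraBarak2009].
* P. W. Shor, *Polynomial-time algorithms for prime factorization and discrete logarithms on a quantum computer*,
  SIAM J. Comput. 26 (1997), §3 [Shor1997].
-/

noncomputable section

namespace Literature.Computability.QuantumComplexity

namespace RevClean

open _root_.Computability Complexity Turing RevDesc RevSim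

variable (e : ℕ) (M : TM2ComputableAux Bool Bool)

/-- **The reversed clean block with empty suffix**: `comp ++ reverse outOps ++ reverse comp`. [cite: Bennett1973, §2] -/
theorem cleanOps_nil_reverse (N : ℕ) :
    (cleanOps e M N []).reverse = comp e M N ++ ((outOps e M N).reverse ++ (comp e M N).reverse) := by
  rw [cleanOps]
  simp only [notsV, List.length_nil, Nat.add_zero, List.range_zero, List.filter_nil, List.map_nil, List.nil_append,
    List.append_nil, List.reverse_append, List.reverse_reverse, List.append_assoc]

variable {e M}

/-- The reversal of the reversed-token read-out stream is the stream of the reversed read-out. [folklore] -/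
theorem reverse_out_outGR {NE : GE} (hNE : InUU NE) (env : GV → ℕ) :
    ((outGW e M opsGR NE).out env).reverse = (outOps e M (NE.eval env)).reverse.flatMap opToks := by
  rw [out_outGW (fun op => (opToks op).reverse) out_opsGR loopVars_opsGR_sub hNE, List.reverse_flatMap]
  simp only [Function.comp_def, List.reverse_reverse]

/-- Loop variables of the generators used. [folklore] -/
theorem uu_notMem_loopVars_compG (NE : GE) : GV.uu ∉ (compGW e M opsG NE).loopVars := fun h => by
  rcases loopVars_compGW_sub loopVars_opsG_sub NE _ h with h | h | h <;> exact absurd h (by decide)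

/-- Loop variables of the generators used. [folklore] -/
theorem uu_notMem_loopVars_outGR (NE : GE) : GV.uu ∉ (outGW e M opsGR NE).loopVars := fun h => by
  rcases loopVars_outGW_sub loopVars_opsGR_sub NE _ h with h | h | h <;> exact absurd h (by decide)

/-- **The description of a reversed clean block (empty suffix) is polynomial time**: for a tableau length `N(u)` given
by an expression in the family index, `1ᵘ ↦ ((cleanOps e M (N u) []).reverse).flatMap opBits ∈ FP`.
[cite: AroraBarak2009, §6.2 Def. 6.12 and Remark 6.7] [cite: Shor1997, §3] -/
theorem flatMap_opBits_cleanOps_reverse_mem_FP {NE : GE} (hNE : InUU NE) :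
    (fun z : List Bool => ((cleanOps e M (NE.eval (envU z.length)) []).reverse).flatMap opBits) ∈ FP := by
  have h1 := GStmt.render_out_mem_FP (compGW e M opsG NE) GV.uu (uu_notMem_loopVars_compG NE)
    (noReuse_compGW loopVars_opsG_sub noReuse_opsG NE)
  have h2 := render_reverse_out_mem_FP (outGW e M opsGR NE) GV.uu (uu_notMem_loopVars_outGR NE)
    (noReuse_outGW loopVars_opsGR_sub noReuse_opsGR NE)
  have h3 := render_reverse_out_mem_FP (compGW e M opsGR NE) GV.uu (uu_notMem_loopVars_compGR NE)
    (noReuse_compGW loopVars_opsGR_sub noReuse_opsGR NE)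
  have h := append_mem_FP h1 (append_mem_FP h2 h3)
  refine (congrArg (· ∈ FP) (funext fun z => ?_)).mpr h
  set u := z.length
  have e1 : Tok.render 0 ((compGW e M opsG NE).out (GenProg.initEnv GV.uu u)) = (comp e M (NE.eval (envU u))).flatMap opBits := by
    rw [show GenProg.initEnv GV.uu u = envU u from rfl, out_compG hNE, render_flatMap_opToks_nil]
  have e2 : Tok.render 0 ((outGW e M opsGR NE).out (GenProg.initEnv GV.uu u)).reverse =
      (outOps e M (NE.eval (envU u))).reverse.flatMap opBits := by
    rw [show GenProg.initEnv GV.uu u = envU u from rfl, reverse_out_outGR hNE, render_flatMap_opToks_nil]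
  have e3 : Tok.render 0 ((compGW e M opsGR NE).out (GenProg.initEnv GV.uu u)).reverse =
      (comp e M (NE.eval (envU u))).reverse.flatMap opBits := by
    rw [show GenProg.initEnv GV.uu u = envU u from rfl, reverse_out_compGR hNE, render_flatMap_opToks_nil]
  change _ = Tok.render 0 ((compGW e M opsG NE).out (GenProg.initEnv GV.uu u)) ++
    (Tok.render 0 ((outGW e M opsGR NE).out (GenProg.initEnv GV.uu u)).reverse ++
      Tok.render 0 ((compGW e M opsGR NE).out (GenProg.initEnv GV.uu u)).reverse)
  rw [e1, e2, e3, cleanOps_nil_reverse]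
  simp only [List.flatMap_append]

/-- The family-index instance `N(u) = u`. [folklore] -/
theorem flatMap_opBits_cleanOps_reverse_mem_FP_id :
    (fun z : List Bool => ((cleanOps e M z.length []).reverse).flatMap opBits) ∈ FP :=
  flatMap_opBits_cleanOps_reverse_mem_FP (e := e) (M := M) (NE := .var .uu) (fun x hx => by simpa [GExpr.fv] using hx)

end RevClean

end Literature.Computability.QuantumComplexity

end
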